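import Summits.HodgeConjecture.CorCM.CommonQuarticCMSubfieldFieldOfDefinition
import Summits.HodgeConjecture.CorCM.CommonCMSubfieldCapacity
import Literature.NumberTheory.ComplexMultiplication.CMTori
import HarnessLib

/-!
# Nondegenerate types of an octic CM field over a quartic CM subfield have exactly ONE UNSPLIT PAIR, and their
# field of definition `F(z₁(a), x₂(b))` is genuinely biquadratic (`z₁(a)·x₂(b) ∉ F`)

COR-CM (cell `pub-hodgecm2`, binder seat `b16` gen 50, count-neutral claim CM44-COMMONQUARTIC, file F4a; theorems only,
no definition, no named fact, no `sorry`).  NEW as packaged, hence under `Summits/`.  `HC_CM` is neither used nor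
asserted.

* §1 **`not_isNondegenerate_of_fix_place`** — a type of `K` stabilised by every automorphism of `ℂ` fixing a place
  `z₁` of a subfield `k` with `[K:ℚ] = 2[k:ℚ]` is DEGENERATE: its `Aut(ℂ)`-orbit injects into `Hom(k, ℂ)`
  (`card_orbit_le_of_fix_place`), so `rank ≤ [k:ℚ]/2 + 1` by Shimura §32.10 (`IsCMTypeWith.card_le_card_orbit_of_
  typeRank_eq`).
* §2 `not_unsplit_of_isNondegenerate_of_unsplit` — over a totally complex QUARTIC `k`, a nondegenerate type unsplit
  at `u` is split at every place outside `{u, ū}` (else all places are unsplit, the type is induced (Streng 3.2) and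
  Kubota's separation fails); **`exists_unsplit_split_of_isNondegenerate`** — a nondegenerate type has EXACTLY ONE
  unsplit pair: data `z₁` (fibre inside `Φ`), `z₂ ∉ {z₁, z̄₁}`, `x₂ ∈ Φ` over `z₂`, `x₂ ∘ τ ∉ Φ` (zero shadow is
  excluded by the tree's Yanai bound `not_isNondegenerate_of_shadow_eq_zero`).
* §3 **`mul_notMem_of_isNondegenerate`** — for such data and anti-real generators `a ∈ k`, `b ∈ K` (F3):
  `z₁(a) · x₂(b) ∉ F = normalClosure ℚ k⁺ ℂ` (otherwise `Φ` is defined over `z₁(k)` and §1 applies) — the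
  independence hypothesis `hind` of the engine `CorCM/CommonQuarticCMSubfieldBiquadraticLattice`.

## References

* [Shimura1998] G. Shimura, *Abelian Varieties with Complex Multiplication and Modular Functions*, §8.3, §32.10.
* [Kubota1965] T. Kubota, *On the field extension by complex multiplication*, Trans. AMS 118 (1965), §2.
* [Streng2010] M. Streng, *Complex multiplication of abelian surfaces*, Ch. I Def. 3.2.
-/

set_option autoImplicit false

noncomputable section

open scoped ComplexConjugate Pointwise
open NumberField NumberField.ComplexEmbedding Module

namespace Summit.HodgeConjecture.CorCM.OcticOverQuartic

open Literature.NumberTheory.ComplexMultiplication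
open Literature.AlgebraicGeometry.Motives (CMType)
open Literature.AlgebraicGeometry.Pohlmann1968

/-! ### §1 A type stabilised by the fixator of a place of a small subfield is degenerate -/

section Orbit

variable {k K : Type} [Field k] [NumberField k] [Field K] [NumberField K]

omit [NumberField K] in
/-- If `σ • z₁ = z₁ ⟹ σΦ = Φ`, then `g • Φ ↦ g • z₁` is a well-defined injection of the orbit of `Φ` into `Hom(k, ℂ)`:
**`|Aut(ℂ) • Φ| ≤ [k : ℚ]`**. [cite: Shimura1998, §8.3] -/
theorem card_orbit_le_of_fix_place (z₁ : k →+* ℂ) (Φ : CMType K)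
    (hdef : ∀ σ : ℂ ≃+* ℂ, σ • z₁ = z₁ → ∀ x : K →+* ℂ, σ • x ∈ Φ.1 ↔ x ∈ Φ.1) :
    Nat.card (MulAction.orbit (ℂ ≃+* ℂ) Φ.1) ≤ finrank ℚ k := by
  classical
  -- stabilising as a set
  have hset : ∀ σ : ℂ ≃+* ℂ, σ • z₁ = z₁ → σ • Φ.1 = Φ.1 := by
    intro σ hσ
    ext x
    rw [Set.mem_smul_set_iff_inv_smul_mem, ← hdef σ hσ (σ⁻¹ • x), smul_inv_smul]
  let f : MulAction.orbit (ℂ ≃+* ℂ) Φ.1 → (k →+* ℂ) := fun S => (Classical.choose (MulAction.mem_orbit_iff.1 S.2)) • z₁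
  have hf : ∀ S : MulAction.orbit (ℂ ≃+* ℂ) Φ.1, (Classical.choose (MulAction.mem_orbit_iff.1 S.2)) • Φ.1 = S.1 :=
    fun S => Classical.choose_spec (MulAction.mem_orbit_iff.1 S.2)
  have hinj : Function.Injective f := by
    intro S S' h
    set g := Classical.choose (MulAction.mem_orbit_iff.1 S.2) with hg
    set g' := Classical.choose (MulAction.mem_orbit_iff.1 S'.2) with hg'
    have h1 : (g'⁻¹ * g) • z₁ = z₁ := by
      change g • z₁ = g' • z₁ at h
      rw [mul_smul, h, inv_smul_smul]
    have h2 : g • Φ.1 = g' • Φ.1 := by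
      have := hset _ h1
      rw [mul_smul] at this
      have h3 := congrArg (fun T : Set (K →+* ℂ) => g' • T) this
      simp only [smul_inv_smul] at h3
      exact h3
    apply Subtype.ext
    rw [← hf S, ← hf S', ← hg, ← hg', h2]
  have h := Nat.card_le_card_of_injective f hinj
  rwa [Nat.card_eq_fintype_card (α := k →+* ℂ), Embeddings.card] at h

variable [IsCMField K]

/-- **A type stabilised by the fixator of a place of `k`, `[K:ℚ] = 2[k:ℚ]`, is DEGENERATE** (`rank ≤ |orbit|/2 + 1
≤ [k:ℚ]/2 + 1 < [K:ℚ]/2 + 1`). [cite: Shimura1998, §32.10] -/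
theorem not_isNondegenerate_of_fix_place (z₁ : k →+* ℂ) (h2 : finrank ℚ K = 2 * finrank ℚ k) (Φ : CMType K)
    (hdef : ∀ σ : ℂ ≃+* ℂ, σ • z₁ = z₁ → ∀ x : K →+* ℂ, σ • x ∈ Φ.1 ↔ x ∈ Φ.1) : ¬ IsNondegenerate Φ := by
  classical
  intro hnd
  haveI := isPretransitive_ringEquiv_complex (K := K)
  let φh : K →+* ℂ := Classical.choice inferInstance
  have hrank : typeRank (ℂ ≃+* ℂ) Φ.1 = Fintype.card (K →+* ℂ) / 2 + 1 := by
    rw [Embeddings.card]; exact hnd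
  have h1 : Fintype.card (K →+* ℂ) / 2 ≤ Nat.card (MulAction.orbit (ℂ ≃+* ℂ) Φ.1) / 2 :=
    (isCMTypeWith_conj Φ).card_le_card_orbit_of_typeRank_eq φh hrank
  have h3 : Nat.card (MulAction.orbit (ℂ ≃+* ℂ) Φ.1) ≤ finrank ℚ k := card_orbit_le_of_fix_place z₁ Φ hdef
  rw [Embeddings.card, h2, Nat.mul_div_cancel_left _ two_pos] at h1
  have hk : 0 < finrank ℚ k := finrank_pos
  omega

end Orbit

/-! ### §2 Exactly one unsplit pair -/

section Unsplit

variable {k K : Type} [Field k] [NumberField k] [IsTotallyComplex k] [Field K] [NumberField K] [IsCMField K]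

omit [NumberField k] [IsTotallyComplex k] in
/-- Split at `w` ⟹ split at `w̄`. [cite: Shimura1998, §18.1] -/
theorem not_unsplit_conj_of_not_unsplit (e : k →+* K) (Φ : CMType K) {w : k →+* ℂ}
    (hw : ¬ ∀ y y' : K →+* ℂ, y.comp e = w → y'.comp e = w → (y ∈ Φ.1 ↔ y' ∈ Φ.1)) :
    ¬ ∀ y y' : K →+* ℂ, y.comp e = (starRingAut : ℂ ≃+* ℂ) • w → y'.comp e = (starRingAut : ℂ ≃+* ℂ) • w →
      (y ∈ Φ.1 ↔ y' ∈ Φ.1) := fun h => by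
  have h' := unsplit_conj_of_unsplit e Φ h
  rw [conj_smul_conj_smul] at h'
  exact hw h'

/-- **A nondegenerate type over a totally complex quartic `k` (`[K:ℚ] = 2[k:ℚ]`) unsplit at `u` is split at every place
outside `{u, ū}`** — otherwise every place is unsplit, the type is induced from `k`, and Kubota's separation property of
nondegenerate types fails. [cite: Streng2010, Ch. I Def. 3.2] [cite: Kubota1965, §2] -/
theorem not_unsplit_of_isNondegenerate_of_unsplit (hk : finrank ℚ k = 4) (e : k →+* K)
    (h2 : finrank ℚ K = 2 * finrank ℚ k) (Φ : CMType K) (hnd : IsNondegenerate Φ) {u : k →+* ℂ}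
    (hu : ∀ y y' : K →+* ℂ, y.comp e = u → y'.comp e = u → (y ∈ Φ.1 ↔ y' ∈ Φ.1)) (z : k →+* ℂ) (hz : z ≠ u)
    (hz' : z ≠ (starRingAut : ℂ ≃+* ℂ) • u) :
    ¬ ∀ y y' : K →+* ℂ, y.comp e = z → y'.comp e = z → (y ∈ Φ.1 ↔ y' ∈ Φ.1) := by
  classical
  intro hzu
  have hall : ∀ (w : k →+* ℂ) (y y' : K →+* ℂ), y.comp e = w → y'.comp e = w → (y ∈ Φ.1 ↔ y' ∈ Φ.1) := by
    intro w
    by_cases h1 : w = u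
    · subst h1; exact hu
    by_cases h2' : w = (starRingAut : ℂ ≃+* ℂ) • u
    · subst h2'; exact unsplit_conj_of_unsplit e Φ hu
    rcases eq_or_eq_conj_of_finrank_eq_four hk hz hz' w h1 h2' with rfl | rfl
    · exact hzu
    · exact unsplit_conj_of_unsplit e Φ hzu
  obtain ⟨Φ₁, hΦ⟩ := exists_inducedCMType_eq_of_forall_unsplit e Φ hall
  have hlt : finrank ℚ k < finrank ℚ K := by rw [h2]; have := (finrank_pos : 0 < finrank ℚ k); omega
  obtain ⟨s, t, hst, hpat⟩ := exists_ne_of_inducedCMType e Φ₁ hlt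
  rw [hΦ] at hpat
  haveI := isPretransitive_ringEquiv_complex (K := K)
  have hrank : typeRank (ℂ ≃+* ℂ) Φ.1 = Fintype.card (K →+* ℂ) / 2 + 1 := by
    rw [Embeddings.card]; exact hnd
  exact hst ((isCMTypeWith_conj Φ).eq_of_forall_smul_mem_iff_of_typeRank_eq hrank fun g => hpat g)

omit [IsTotallyComplex k] [Field K] [NumberField K] [IsCMField K] in
/-- There is a place outside a conjugate pair (`[k:ℚ] = 4`). [folklore] -/
theorem exists_ne_ne_conj (hk : finrank ℚ k = 4) (z : k →+* ℂ) :
    ∃ z' : k →+* ℂ, z' ≠ z ∧ z' ≠ (starRingAut : ℂ ≃+* ℂ) • z := by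
  classical
  by_contra h
  rw [not_exists] at h
  have hsub : (Finset.univ : Finset (k →+* ℂ)) ⊆ {z, (starRingAut : ℂ ≃+* ℂ) • z} := by
    intro w _
    simp only [Finset.mem_insert, Finset.mem_singleton]
    by_contra hw
    rw [not_or] at hw
    exact h w ⟨hw.1, hw.2⟩
  have h1 := Finset.card_le_card hsub
  rw [Finset.card_univ, Embeddings.card, hk] at h1
  have h2 := Finset.card_le_two (a := z) (b := (starRingAut : ℂ ≃+* ℂ) • z)
  omega

end Unsplit

section OnePair

variable {I : Type} {K : I → Type} [∀ i, Field (K i)] [∀ i, NumberField (K i)] [∀ i, IsCMField (K i)]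
variable {k : Type} [Field k] [NumberField k] [IsCMField k]

omit [IsCMField k] in
/-- From an unsplit pair at `z` and a split place `z'`: the data `(z₁, z₂, x₂)` with the fibre of `z₁` inside `Φ`,
`z₂ = z' ∉ {z₁, z̄₁}`, `x₂ ∈ Φ` over `z₂`, `x₂ ∘ τ ∉ Φ`. [cite: Shimura1998, §18.1] -/
theorem exists_unsplit_split_of_unsplit_of_not_unsplit {i : I} (e : k →+* K i)
    (h2 : finrank ℚ (K i) = 2 * finrank ℚ k) (τ : K i ≃ₐ[ℚ] K i) (hτ1 : τ ≠ 1) (hτe : ∀ x : k, τ (e x) = e x)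
    (Φ : CMType (K i)) {z z' : k →+* ℂ}
    (hz : ∀ y y' : K i →+* ℂ, y.comp e = z → y'.comp e = z → (y ∈ Φ.1 ↔ y' ∈ Φ.1))
    (hz' : ¬ ∀ y y' : K i →+* ℂ, y.comp e = z' → y'.comp e = z' → (y ∈ Φ.1 ↔ y' ∈ Φ.1)) (h1 : z' ≠ z)
    (h1' : z' ≠ (starRingAut : ℂ ≃+* ℂ) • z) :
    ∃ (z₁ z₂ : k →+* ℂ) (x₂ : K i →+* ℂ), (∀ y : K i →+* ℂ, y.comp e = z₁ → y ∈ Φ.1) ∧ z₂ ≠ z₁ ∧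
      z₂ ≠ (starRingAut : ℂ ≃+* ℂ) • z₁ ∧ x₂.comp e = z₂ ∧ x₂ ∈ Φ.1 ∧ x₂.comp τ.toRingEquiv.toRingHom ∉ Φ.1 := by
  have hCM := isCMTypeWith_conj Φ
  -- the split place gives `x₂ ∈ Φ` with `x₂ ∘ τ ∉ Φ`
  obtain ⟨x₂, hx₂e, hx₂Φ, hx₂τ⟩ : ∃ x₂ : K i →+* ℂ, x₂.comp e = z' ∧ x₂ ∈ Φ.1 ∧
      x₂.comp τ.toRingEquiv.toRingHom ∉ Φ.1 := by
    by_contra hnone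
    refine hz' fun y y' hye hy'e => ?_
    have key : ∀ w : K i →+* ℂ, w.comp e = z' → w ∈ Φ.1 → w.comp τ.toRingEquiv.toRingHom ∈ Φ.1 := by
      intro w hwe hwΦ
      by_contra hwτ
      exact hnone ⟨w, hwe, hwΦ, hwτ⟩
    have hyy' := (comp_eq_comp_iff e h2 τ hτ1 hτe y y').1 (hy'e.trans hye.symm)
    have hy'y := (comp_eq_comp_iff e h2 τ hτ1 hτe y' y).1 (hye.trans hy'e.symm)
    constructor
    · intro hy
      rcases hyy' with rfl | rfl
      · exact hy
      · exact key y hye hy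
    · intro hy'
      rcases hy'y with rfl | rfl
      · exact hy'
      · exact key y' hy'e hy'
  by_cases hin : ∃ y : K i →+* ℂ, y.comp e = z ∧ y ∈ Φ.1
  · obtain ⟨y₀, hy₀e, hy₀Φ⟩ := hin
    exact ⟨z, z', x₂, fun y hy => (hz y y₀ hy hy₀e).2 hy₀Φ, h1, h1', hx₂e, hx₂Φ, hx₂τ⟩
  · refine ⟨(starRingAut : ℂ ≃+* ℂ) • z, z', x₂, fun y hy => ?_, h1', ?_, hx₂e, hx₂Φ, hx₂τ⟩
    · by_contra hyΦ
      have h3 : ((starRingAut : ℂ ≃+* ℂ) • y).comp e = z := by rw [smul_comp_ringHom, hy, conj_smul_conj_smul]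
      exact hin ⟨_, h3, (hCM.rho_smul_mem_iff y).2 hyΦ⟩
    · rw [conj_smul_conj_smul]; exact h1

/-- **A NONDEGENERATE type of `K_i`, `[K_i:ℚ] = 2[k:ℚ]`, over a quartic CM field `k` has exactly ONE UNSPLIT PAIR**:
there are `z₁` with the whole fibre of `z₁` in `Φ`, `z₂ ∉ {z₁, z̄₁}`, and `x₂ ∈ Φ` over `z₂` with `x₂ ∘ τ ∉ Φ` (zero
shadow is degenerate by Yanai's bound, two unsplit pairs make the type induced). [cite: Shimura1998, §18.1]
[cite: Streng2010, Ch. I Def. 3.2] -/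
theorem exists_unsplit_split_of_isNondegenerate (hk : finrank ℚ k = 4) {i : I} (e : k →+* K i)
    (h2 : finrank ℚ (K i) = 2 * finrank ℚ k) (τ : K i ≃ₐ[ℚ] K i) (hτ1 : τ ≠ 1) (hτe : ∀ x : k, τ (e x) = e x)
    (Φ : CMType (K i)) (hnd : IsNondegenerate Φ) :
    ∃ (z₁ z₂ : k →+* ℂ) (x₂ : K i →+* ℂ), (∀ y : K i →+* ℂ, y.comp e = z₁ → y ∈ Φ.1) ∧ z₂ ≠ z₁ ∧
      z₂ ≠ (starRingAut : ℂ ≃+* ℂ) • z₁ ∧ x₂.comp e = z₂ ∧ x₂ ∈ Φ.1 ∧ x₂.comp τ.toRingEquiv.toRingHom ∉ Φ.1 := by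
  classical
  let z : k →+* ℂ := Classical.choice inferInstance
  obtain ⟨z', hz'1, hz'2⟩ := exists_ne_ne_conj hk z
  set c : ℂ ≃+* ℂ := starRingAut with hc
  by_cases hu : ∀ y y' : K i →+* ℂ, y.comp e = z → y'.comp e = z → (y ∈ Φ.1 ↔ y' ∈ Φ.1)
  · have hu' := not_unsplit_of_isNondegenerate_of_unsplit hk e h2 Φ hnd hu z' hz'1 hz'2
    exact exists_unsplit_split_of_unsplit_of_not_unsplit e h2 τ hτ1 hτe Φ hu hu' hz'1 hz'2
  by_cases hu' : ∀ y y' : K i →+* ℂ, y.comp e = z' → y'.comp e = z' → (y ∈ Φ.1 ↔ y' ∈ Φ.1)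
  · have hzz'1 : z ≠ z' := fun h => hz'1 h.symm
    have hzz'2 : z ≠ c • z' := fun h => hz'2 (by rw [h, conj_smul_conj_smul])
    exact exists_unsplit_split_of_unsplit_of_not_unsplit e h2 τ hτ1 hτe Φ hu' hu hzz'1 hzz'2
  -- all four places split: zero shadow, degenerate
  exfalso
  refine not_isNondegenerate_of_shadow_eq_zero e h2 Φ (fun w => ?_) hnd
  rw [card_filter_comp_eq_two e h2 w]
  have hsplit : ¬ ∀ y y' : K i →+* ℂ, y.comp e = w → y'.comp e = w → (y ∈ Φ.1 ↔ y' ∈ Φ.1) := by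
    by_cases h1 : w = z
    · rw [h1]; exact hu
    by_cases h1' : w = c • z
    · rw [h1']; exact not_unsplit_conj_of_not_unsplit e Φ hu
    rcases eq_or_eq_conj_of_finrank_eq_four hk hz'1 hz'2 w h1 h1' with rfl | rfl
    · exact hu'
    · exact not_unsplit_conj_of_not_unsplit e Φ hu'
  rw [card_filter_comp_mem_of_split e h2 Φ hsplit]

end OnePair

/-! ### §3 The field of definition is biquadratic: `z₁(a) · x₂(b) ∉ F` -/

section Independence

variable {k K : Type} [Field k] [NumberField k] [IsCMField k] [Field K] [NumberField K] [IsCMField K]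

/-- An automorphism fixing the place `z₁` fixes `F = z₁(k⁺)` pointwise. [cite: Shimura1998, §8.1] -/
theorem apply_eq_of_smul_eq_of_mem_normalClosure (hk : finrank ℚ k = 4) (z₁ : k →+* ℂ) {σ : ℂ ≃+* ℂ}
    (hσ : σ • z₁ = z₁) {t : ℂ} (ht : t ∈ IntermediateField.normalClosure ℚ (maximalRealSubfield k) ℂ) : σ t = t := by
  obtain ⟨r, -, rfl⟩ := exists_apply_eq_of_mem_normalClosure hk z₁ ht
  have := RingHom.congr_fun hσ r
  rwa [ringEquiv_smul_apply] at this

/-- **`z₁(a) · x₂(b) ∉ F` for a nondegenerate one-unsplit-pair type** — otherwise `β = x₂(b) ∈ F·α⁻¹` is fixed by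
every automorphism fixing the place `z₁`, so `Φ` is stabilised by the fixator of `z₁` (F3b) and is degenerate (§1).
[cite: Shimura1998, §8.3 and §32.10] -/
theorem mul_notMem_of_isNondegenerate (hk : finrank ℚ k = 4) (e : k →+* K) (h2 : finrank ℚ K = 2 * finrank ℚ k)
    (τ : K ≃ₐ[ℚ] K) (hτ1 : τ ≠ 1) (hτe : ∀ x : k, τ (e x) = e x) {a : k} (ha0 : a ≠ 0)
    (ha : IsCMField.complexConj k a = -a) {b : K} (hb0 : b ≠ 0) (hρb : IsCMField.complexConj K b = -b)
    (hτb : τ b = -b) (Φ : CMType K) (hnd : IsNondegenerate Φ) {z₁ z₂ : k →+* ℂ}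
    (hz₁ : ∀ y : K →+* ℂ, y.comp e = z₁ → y ∈ Φ.1) (hz₂ : z₂ ≠ z₁) (hz₂' : z₂ ≠ (starRingAut : ℂ ≃+* ℂ) • z₁)
    {x₂ : K →+* ℂ} (hx₂e : x₂.comp e = z₂) (hx₂Φ : x₂ ∈ Φ.1) (hsplit : x₂.comp τ.toRingEquiv.toRingHom ∉ Φ.1) :
    z₁ a * x₂ b ∉ IntermediateField.normalClosure ℚ (maximalRealSubfield k) ℂ := by
  intro hmem
  refine not_isNondegenerate_of_fix_place z₁ h2 Φ (fun σ hσ => ?_) hnd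
  have hα : σ (z₁ a) = z₁ a := by
    have := RingHom.congr_fun hσ a
    rwa [ringEquiv_smul_apply] at this
  have hα0 : z₁ a ≠ 0 := (map_ne_zero z₁).2 ha0
  have hβ : σ (x₂ b) = x₂ b := by
    have h1 : x₂ b = z₁ a * x₂ b * (z₁ a)⁻¹ := by field_simp
    rw [h1, map_mul, map_inv₀, hα, apply_eq_of_smul_eq_of_mem_normalClosure hk z₁ hσ hmem]
  exact forall_smul_mem_iff_of_fix hk e h2 τ hτ1 hτe ha0 ha hb0 hρb hτb Φ hz₁ hz₂ hz₂' hx₂e hx₂Φ hsplit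
    (fun t ht => apply_eq_of_smul_eq_of_mem_normalClosure hk z₁ hσ ht) hα hβ

end Independence

end Summit.HodgeConjecture.CorCM.OcticOverQuartic

end
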